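import Summits.BirchSwinnertonDyer.BirchSwinnertonDyer.Theorems.PrintCf2RubinValueTwoLinePinDefectUndecomposed
import Summits.BirchSwinnertonDyer.BirchSwinnertonDyer.Theorems.PrintCf2SplitBadTwoFirstLayerOfFrame
import Summits.BirchSwinnertonDyer.BirchSwinnertonDyer.Theorems.PrintCf2SplitBadTwoCMPrimaryLocalPinning
import Literature.RingTheory.DiscreteValuationRing.AdicCompletionResidueField
import Literature.NumberTheory.GaloisRepresentations.DecompositionFieldRigidity
import Literature.NumberTheory.Automorphic.PairLFunctionBaseChange
import Literature.NumberTheory.GaloisRepresentations.ArtinDirichletCoefficients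
import Literature.NumberTheory.GaloisRepresentations.DirichletCharacterOfGaloisCharacter
import Literature.NumberTheory.Automorphic.SatakeParameterTrivialBound
import HarnessLib

/-!
# M-LINE-PIN, (C2b) part 5: `v̄` IS UNDECOMPOSED IN EVERY `ℤ₂`-LINE OF THE FRAME FIELD UNRAMIFIED OUTSIDE `v` —
# the displayed input (U) of part 4 is a theorem on the frame (a dyadic non-square: `−β′ ≢ □` in `K_{v̄}`)

Cell `bsd-print-cf2`, width seat `bsd-line-cf2c-w8` g4 (prover-bsd-line-cf2c-w8-g4-0), planner g19's named piece M-LINE-PIN, step (C2b)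
(memo `Cruxes/TwoVariableMainConjAtSplitTwo/M-LINE-PIN-cf2c-w8g3.md` §2/§8); sequel of part 4 (p702352). `--supports stmt-BirchSwinnertonDyer-24086
--as helper`, Theses-free. HONEST FRAMING: frame-level arithmetic of the field `K = ℚ(θ)`, `θ² = −7` (road α: `C • W = cm7^{(d)}`, the two
places `v ≠ v̄` above `2`); it discharges the input (U) «`D_{v̄} ⊄ κ₁⁻¹(2ℤ₂)`» of part 4 for every `ℤ₂`-extension `κ₁` unramified outside `v`
(the first slot's line of M-LINE-PIN), whence a decomposition element `τ ∈ D_{v̄}` with `κ₁ τ = κ₁ γ₁`. It does not touch (LS)_v. No summit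
statement is proved by this seat; BSD is not proved by any of this. THEOREMS ONLY (no definition, no named fact, no `sorry`).

WHAT. -w6 g2's first-layer identification (`FirstLayer.layerSubgroup_one_eq_stabilizer_geomSqrt_neg`, stated for a line unramified outside
ONE of the two dyadic places, here read with `v ↔ v̄` exchanged): the first layer of `κ₁` is `K(√−β′)`, `β′(1−β′) = 2`, `β′ ∈ v`; and its door
`FirstLayer.not_decomp_le_layerSubgroup_one_of_exists_smul_ne`: it suffices that SOME `δ ∈ D_{v̄}` moves `√−β′`. This file supplies that mover:
* §1 dyadic units: in `K_w` with residue field `𝔽₂` (`#(𝓞_K ⧸ w) = 2`) every integer `x` has `|x² − x|_w < 1` (`valued_sq_sub_self_lt_one`), so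
  if moreover `|2|_w = |ϖ|` (`e = 1`) every unit `r` has **`|r² − 1|_w ≤ |8|_w`** (`valued_sq_sub_one_le_exp_neg_three`: `r = 1 + 2s`,
  `r² − 1 = 4s(s+1)`);
* §2 the frame: `#(𝓞_K ⧸ v̄) = 2` (`e = f = 1` above `2`), and `ord_{v̄}(β′ + 1) = 2` EXACTLY from `(β′+1)(2−β′) = 4` (`intValuation_add_one_eq`);
* §3 hence **`−β′` is not a square in `K_{v̄}`** (`not_exists_sq_eq_neg_of_frame`: `r² = −β′` would give `|r²−1| = |β′+1| = |4| > |8|`), so by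
  the decomposition-field dictionary (`mem_range_of_forall_absGaloisRestrict_smul_eq`: an element of `K̄` fixed by `D_{v̄}` lies in `K_{v̄}`)
  **some `δ ∈ D_{v̄}` moves `√−β′`** (`exists_mem_decomp_vbar_smul_geomSqrt_neg_ne`);
* §4 **(U)**: `not_decomp_vbar_le_layerSubgroup_one_of_isUnramifiedOutside` — for every `κ₁ : ZpExtension K 2` unramified outside `v`,
  `¬ D_{v̄} ≤ κ₁⁻¹(2ℤ₂)`; and `exists_mem_decomp_vbar_apply_eq_of_isUnramifiedOutside` — `∃ τ ∈ D_{v̄}, κ₁ τ = κ₁ γ₁` (part 4).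
presearch: Serre *Cours d'arithmétique* II §3.3 (squares in `ℚ₂`: a unit is a square iff `≡ 1 (mod 8)`), Neukirch II (9.6), Washington §13.1 —
held; tree: -w2 g9's Hensel direction `exists_sq_eq_adicCompletion_of_emod_eight` (squares `≡ 1 (8)`) is the converse; no new fact.
beyond-print theorem: no.

References: [Serre1973] Ch. II §3.3; [NeukirchANT1999] Ch. II §4 (4.3), §9 (9.6); [Washington1997] §13.1; [Lang1983] Ch. 6 Prop. 1.3.
-/

noncomputable section

open scoped Classical NumberField Valued

-- the summit namespace `Summit.BirchSwinnertonDyer.BirchSwinnertonDyer` repeats the problem name by design (D-0017)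
set_option linter.dupNamespace false
set_option autoImplicit false

open NumberField IsDedekindDomain Field WeierstrassCurve
open Literature.NumberTheory Literature.NumberTheory.EllipticCurves Literature.NumberTheory.GaloisRepresentations
open Summit.BirchSwinnertonDyer.BirchSwinnertonDyer.Theorems.PrintCf2

namespace Summit.BirchSwinnertonDyer.BirchSwinnertonDyer.Theorems.PrintCf2.LinePin

/-! ## §1. Dyadic units: `|x² − x| < 1` for integers, `|r² − 1| ≤ |8|` for units (residue field `𝔽₂`, `e = 1`) -/

section Dyadic

variable {K : Type} [Field K] [NumberField K]

/-- **Residue field `𝔽₂`: `|x² − x|_w < 1` for every `w`-adic integer `x` of `K_w`** (`#(𝓞_K ⧸ w) = 2`, so the residue field of `𝒪_{K_w}`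
has two elements and `x̄² = x̄`). [cite: SerreLocalFields1979, Ch. II §1] [cite: NeukirchANT1999, Ch. II §4 Prop. (4.3)] -/
theorem valued_sq_sub_self_lt_one (w : HeightOneSpectrum (𝓞 K)) (h2 : Nat.card (𝓞 K ⧸ w.asIdeal) = 2)
    (x : w.adicCompletion K) (hx : Valued.v x ≤ 1) : Valued.v (x ^ 2 - x) < 1 := by
  let y : w.adicCompletionIntegers K := ⟨x, hx⟩
  have hcard : Nat.card (IsLocalRing.ResidueField (w.adicCompletionIntegers K)) = 2 := by
    rw [HeightOneSpectrum.natCard_residueField_adicCompletionIntegers K w, h2]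
  haveI : Finite (IsLocalRing.ResidueField (w.adicCompletionIntegers K)) := Nat.finite_of_card_ne_zero (by rw [hcard]; decide)
  letI : Fintype (IsLocalRing.ResidueField (w.adicCompletionIntegers K)) := Fintype.ofFinite _
  have hq : Fintype.card (IsLocalRing.ResidueField (w.adicCompletionIntegers K)) = 2 := by
    rw [← Nat.card_eq_fintype_card, hcard]
  have hres : IsLocalRing.residue (w.adicCompletionIntegers K) (y ^ 2 - y) = 0 := by
    rw [map_sub, map_pow, ← hq, FiniteField.pow_card, sub_self]
  rw [IsLocalRing.residue_eq_zero_iff] at hres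
  have hnu : ¬ IsUnit (y ^ 2 - y) := hres
  rw [HeightOneSpectrum.adicCompletionIntegers.isUnit_iff_valued_eq_one] at hnu
  have hle : Valued.v (((y ^ 2 - y : w.adicCompletionIntegers K)) : w.adicCompletion K) ≤ 1 := (y ^ 2 - y).2
  have hcoe : (((y ^ 2 - y : w.adicCompletionIntegers K)) : w.adicCompletion K) = x ^ 2 - x := rfl
  rw [hcoe] at hle hnu
  exact lt_of_le_of_ne hle hnu

/-- **Unit squares are `≡ 1 (mod 8)`**: in `K_w` with residue field `𝔽₂` and `|2|_w = exp(−1)` (`e = 1`), every `r` with `|r|_w = 1` has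
`|r² − 1|_w ≤ exp(−3) = |8|_w` (`r = 1 + 2s` with `s` integral, `r² − 1 = 4 s(s+1)` and `|s(s+1)| < 1`). [cite: Serre1973, Ch. II §3.3]
[cite: NeukirchANT1999, Ch. II §5] -/
theorem valued_sq_sub_one_le_exp_neg_three (w : HeightOneSpectrum (𝓞 K)) (h2 : Nat.card (𝓞 K ⧸ w.asIdeal) = 2)
    (hw2 : Valued.v (2 : w.adicCompletion K) = WithZero.exp (-1 : ℤ)) (r : w.adicCompletion K) (hr : Valued.v r = 1) :
    Valued.v (r ^ 2 - 1) ≤ WithZero.exp (-3 : ℤ) := by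
  -- `|r − 1| ≤ |2|`
  have h1 : Valued.v (r - 1) ≤ WithZero.exp (-1 : ℤ) := by
    have h := valued_sq_sub_self_lt_one w h2 r hr.le
    rw [show r ^ 2 - r = r * (r - 1) by ring, map_mul, hr, one_mul] at h
    exact Literature.NumberTheory.Automorphic.withZero_le_exp_neg_one_of_lt_one h
  have h20 : (2 : w.adicCompletion K) ≠ 0 := by
    intro h
    rw [h, map_zero] at hw2
    exact WithZero.coe_ne_zero hw2.symm
  -- `s = (r − 1)/2` is integral
  set s : w.adicCompletion K := (r - 1) / 2 with hs
  have hrs : r - 1 = 2 * s := by rw [hs]; field_simp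
  have hsv : Valued.v s ≤ 1 := by
    have h3 : WithZero.exp (-1 : ℤ) * Valued.v s ≤ WithZero.exp (-1 : ℤ) := by
      rw [← hw2, ← map_mul, ← hrs, hw2]; exact h1
    calc Valued.v s = WithZero.exp (1 : ℤ) * (WithZero.exp (-1 : ℤ) * Valued.v s) := by
          rw [← mul_assoc, ← WithZero.exp_add, add_neg_cancel, WithZero.exp_zero, one_mul]
      _ ≤ WithZero.exp (1 : ℤ) * WithZero.exp (-1 : ℤ) := mul_le_mul_right h3 _
      _ = 1 := by rw [← WithZero.exp_add, add_neg_cancel, WithZero.exp_zero]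
  -- `|s(s+1)| < 1`
  have hss : Valued.v (s * (s + 1)) ≤ WithZero.exp (-1 : ℤ) := by
    have hs1 : Valued.v (s + 1) ≤ 1 := Valued.v.map_add_le hsv (by rw [map_one])
    have h := valued_sq_sub_self_lt_one w h2 (s + 1) hs1
    rw [show (s + 1) ^ 2 - (s + 1) = s * (s + 1) by ring] at h
    exact Literature.NumberTheory.Automorphic.withZero_le_exp_neg_one_of_lt_one h
  have hprod : r ^ 2 - 1 = (2 * 2) * (s * (s + 1)) := by
    rw [show r = 2 * s + 1 by rw [← hrs]; ring]
    ring
  calc Valued.v (r ^ 2 - 1) = WithZero.exp (-2 : ℤ) * Valued.v (s * (s + 1)) := by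
        rw [hprod, map_mul, map_mul, hw2, ← WithZero.exp_add]; norm_num
    _ ≤ WithZero.exp (-2 : ℤ) * WithZero.exp (-1 : ℤ) := mul_le_mul_right hss _
    _ = WithZero.exp (-3 : ℤ) := by rw [← WithZero.exp_add]; norm_num

end Dyadic

/-! ## §2. The frame field: `#(𝓞_K ⧸ v̄) = 2` and `ord_{v̄}(β′ + 1) = 2` -/

section Frame

variable {K : Type} [Field K] [NumberField K]

/-- **`#(𝓞_K ⧸ v̄) = 2`** for the two places `v ≠ v̄` above `2` of an imaginary quadratic field (`e = f = 1`: -w3's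
`inertiaDeg_eq_one_of_ne_two`, residue cardinality `= 2^{f}`). [cite: NeukirchANT1999, Ch. I §8 Prop. (8.2)] -/
theorem natCard_quotient_eq_two (hK : IsImaginaryQuadratic K) {v vbar : HeightOneSpectrum (𝓞 K)} (hv : ((2 : ℕ) : 𝓞 K) ∈ v.asIdeal)
    (hvbar : ((2 : ℕ) : 𝓞 K) ∈ vbar.asIdeal) (hne : vbar ≠ v) : Nat.card (𝓞 K ⧸ vbar.asIdeal) = 2 := by
  have hf : vbar.asIdeal.inertiaDeg (𝓞 ℚ) = 1 := CMPrimes.inertiaDeg_eq_one_of_ne_two K hK.1 hvbar hv hne.symm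
  have h := Literature.NumberTheory.Automorphic.residueCard_eq_pow_inertiaDeg (F := ℚ) vbar
  have h2u : ((2 : ℕ) : 𝓞 ℚ) ∈ (vbar.under (𝓞 ℚ)).asIdeal := by
    change ((2 : ℕ) : 𝓞 ℚ) ∈ Ideal.comap (algebraMap (𝓞 ℚ) (𝓞 K)) vbar.asIdeal
    rw [Ideal.mem_comap, map_natCast]
    exact hvbar
  rw [hf, pow_one, Rat.residueCard_eq_natGenerator', natGenerator_eq_of_natCast_mem_asIdeal Nat.prime_two h2u] at h
  rw [← HeightOneSpectrum.residueCard_eq_card_quotient, h]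

/-- **`ord_{v̄}(β′ + 1) = 2`** for `β′(1 − β′) = 2`, `β′ ∈ v` (so `β′` is a `v̄`-unit with `β′ ≡ 1 (mod v̄)`): `(β′ + 1)(2 − β′) = 4` and
`2 − β′ = 1 + (1 − β′)` is a `v̄`-unit. (In `ℚ₂`-coordinates: `β′ ≡ 3`, `−β′ ≡ 5 (mod 8)`.) [cite: NeukirchANT1999, Ch. I §8]
[cite: Washington1997, §13.1] -/
theorem intValuation_add_one_eq (hK : IsImaginaryQuadratic K) {θ : K} (hθ : θ ^ 2 = -7) {d : ℤ} (hd0 : d ≠ 0)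
    (W : WeierstrassCurve ℚ) [W.IsElliptic] {C : VariableChange ℚ} (hC : C • W = cm7.quadraticTwist (d : ℚ))
    {v vbar : HeightOneSpectrum (𝓞 K)} (hv : ((2 : ℕ) : 𝓞 K) ∈ v.asIdeal) (hvbar : ((2 : ℕ) : 𝓞 K) ∈ vbar.asIdeal) (hne : vbar ≠ v)
    {β' : 𝓞 K} (hβ' : β' * (1 - β') = 2) (hβ'v : β' ∈ v.asIdeal) :
    vbar.intValuation (β' + 1) = WithZero.exp (-2 : ℤ) := by
  have h2v := FirstLayer.intValuation_two_of_frame hK hθ hd0 W hC hv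
  have h2vbar := FirstLayer.intValuation_two_of_frame hK hθ hd0 W hC hvbar
  obtain ⟨-, h1β⟩ := FirstLayer.intValuation_v hK hθ hvbar hv hne.symm h2vbar h2v hβ' hβ'v
  -- `2 − β′` is a unit at `v̄`
  have hunit : vbar.intValuation (2 - β') = 1 := by
    rw [show (2 : 𝓞 K) - β' = 1 + (1 - β') by ring]
    exact Valuation.map_one_add_of_lt _ (by rw [h1β, ← WithZero.exp_zero, WithZero.exp_lt_exp]; norm_num)
  have hprod : (β' + 1) * (2 - β') = 4 := by linear_combination hβ'
  have h4 : vbar.intValuation (4 : 𝓞 K) = WithZero.exp (-2 : ℤ) := by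
    rw [show (4 : 𝓞 K) = 2 * 2 by norm_num, map_mul, h2vbar, ← WithZero.exp_add]; norm_num
  have h := congrArg vbar.intValuation hprod
  rw [map_mul, hunit, mul_one, h4] at h
  exact h

/-! ## §3. `−β′` is not a square in `K_{v̄}`; a decomposition element at `v̄` moves `√−β′` -/

/-- **`−β′` IS NOT A SQUARE IN `K_{v̄}`** on the frame (`β′(1−β′) = 2`, `β′ ∈ v`): a square root `r` would be a `v̄`-unit with
`|r² − 1|_{v̄} = |β′ + 1|_{v̄} = |4|`, contradicting `|r² − 1| ≤ |8|` (§1). [cite: Serre1973, Ch. II §3.3] [cite: NeukirchANT1999, Ch. II §5] -/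
theorem not_exists_sq_eq_neg_of_frame (hK : IsImaginaryQuadratic K) {θ : K} (hθ : θ ^ 2 = -7) {d : ℤ} (hd0 : d ≠ 0)
    (W : WeierstrassCurve ℚ) [W.IsElliptic] {C : VariableChange ℚ} (hC : C • W = cm7.quadraticTwist (d : ℚ))
    {v vbar : HeightOneSpectrum (𝓞 K)} (hv : ((2 : ℕ) : 𝓞 K) ∈ v.asIdeal) (hvbar : ((2 : ℕ) : 𝓞 K) ∈ vbar.asIdeal) (hne : vbar ≠ v)
    {β' : 𝓞 K} (hβ' : β' * (1 - β') = 2) (hβ'v : β' ∈ v.asIdeal) :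
    ¬ ∃ r : vbar.adicCompletion K, r ^ 2 = algebraMap K (vbar.adicCompletion K) (-(β' : K)) := by
  rintro ⟨r, hr⟩
  have h2card := natCard_quotient_eq_two hK hv hvbar hne
  have h2vbar := FirstLayer.intValuation_two_of_frame hK hθ hd0 W hC hvbar
  obtain ⟨hβ1, -⟩ := FirstLayer.intValuation_v hK hθ hvbar hv hne.symm h2vbar (FirstLayer.intValuation_two_of_frame hK hθ hd0 W hC hv)
    hβ' hβ'v
  have hval : ∀ x : 𝓞 K, Valued.v (algebraMap K (vbar.adicCompletion K) (x : K)) = vbar.intValuation x := fun x ↦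
    (HeightOneSpectrum.valuedAdicCompletion_eq_valuation' vbar (x : K)).trans (HeightOneSpectrum.valuation_of_algebraMap vbar x)
  -- `|2| = exp(−1)` in `K_{v̄}`
  have hw2 : Valued.v (2 : vbar.adicCompletion K) = WithZero.exp (-1 : ℤ) := by
    have h := hval 2
    have e2 : ((2 : 𝓞 K) : K) = (2 : K) := rfl
    rw [e2, map_ofNat, h2vbar] at h
    exact h
  -- `|r| = 1`
  have hr2 : Valued.v r ^ 2 = 1 := by
    rw [← map_pow, hr, map_neg, Valuation.map_neg, hval β', hβ1]
  have hVr : Valued.v r = 1 := by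
    rcases lt_trichotomy (Valued.v r) 1 with h | h | h
    · exact absurd hr2 (ne_of_lt (pow_lt_one₀ bot_le h two_ne_zero))
    · exact h
    · exact absurd hr2 (ne_of_gt (one_lt_pow₀ h two_ne_zero))
  have hle := valued_sq_sub_one_le_exp_neg_three vbar h2card hw2 r hVr
  -- but `|r² − 1| = |β′ + 1| = exp(−2)`
  have heq : Valued.v (r ^ 2 - 1) = WithZero.exp (-2 : ℤ) := by
    rw [hr, show algebraMap K (vbar.adicCompletion K) (-(β' : K)) - 1 = -(algebraMap K (vbar.adicCompletion K) (((β' + 1 : 𝓞 K)) : K)) by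
      push_cast; ring, Valuation.map_neg, hval, intValuation_add_one_eq hK hθ hd0 W hC hv hvbar hne hβ' hβ'v]
  rw [heq, WithZero.exp_le_exp] at hle
  omega

/-- **SOME `δ ∈ D_{v̄}` MOVES `√−β′`** (`β′(1−β′) = 2`, `β′ ∈ v`, on the frame): otherwise `√−β′`, fixed by the image of `Γ_{K_{v̄}}`, would lie
in `K_{v̄}` (decomposition-field dictionary `mem_range_of_forall_absGaloisRestrict_smul_eq`), i.e. `−β′` would be a square in `K_{v̄}`.
Equivalently: `v̄` is INERT in `K(√−β′)`. [cite: NeukirchANT1999, Ch. II §9 Prop. (9.6)] [cite: Serre1973, Ch. II §3.3] -/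
theorem exists_mem_decomp_vbar_smul_geomSqrt_neg_ne (hK : IsImaginaryQuadratic K) {θ : K} (hθ : θ ^ 2 = -7) {d : ℤ} (hd0 : d ≠ 0)
    (W : WeierstrassCurve ℚ) [W.IsElliptic] {C : VariableChange ℚ} (hC : C • W = cm7.quadraticTwist (d : ℚ))
    {v vbar : HeightOneSpectrum (𝓞 K)} (hv : ((2 : ℕ) : 𝓞 K) ∈ v.asIdeal) (hvbar : ((2 : ℕ) : 𝓞 K) ∈ vbar.asIdeal) (hne : vbar ≠ v)
    {β' : 𝓞 K} (hβ' : β' * (1 - β') = 2) (hβ'v : β' ∈ v.asIdeal) :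
    ∃ δ ∈ GreenbergSelmer.decomp vbar, δ • geomSqrt (-(β' : K)) ≠ geomSqrt (-(β' : K)) := by
  by_contra h
  push Not at h
  have hall : ∀ τ : absoluteGaloisGroup (vbar.adicCompletion K),
      absGaloisRestrict K (vbar.adicCompletion K) τ • geomSqrt (-(β' : K)) = geomSqrt (-(β' : K)) :=
    fun τ ↦ h _ ⟨τ, rfl⟩
  obtain ⟨r, hr⟩ := mem_range_of_forall_absGaloisRestrict_smul_eq K vbar hall
  apply not_exists_sq_eq_neg_of_frame hK hθ hd0 W hC hv hvbar hne hβ' hβ'v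
  refine ⟨r, (algebraMap (vbar.adicCompletion K) (AlgebraicClosure (vbar.adicCompletion K))).injective ?_⟩
  rw [map_pow, hr, ← map_pow, geomSqrt_sq, AlgHom.commutes, ← IsScalarTower.algebraMap_apply]

/-! ## §4. (U): `v̄` is undecomposed in every `ℤ₂`-line of the frame field unramified outside `v` -/

/-- **(U) ON THE FRAME: `¬ D_{v̄} ≤ κ₁⁻¹(2ℤ₂)` for every `ℤ₂`-extension `κ₁` unramified outside `v`** — `v̄` does not split in the first
layer `K₁ = K(√−β′)` of `κ₁` (-w6 g2's `FirstLayer.layerSubgroup_one_eq_stabilizer_geomSqrt_neg` read with `v ↔ v̄` exchanged, and the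
mover of §3). This is the displayed input `hU` of part 4 for the first slot's line of M-LINE-PIN. [cite: Washington1997, §13.1]
[cite: Lang1983, Ch. 6 Prop. 1.3] [cite: NeukirchANT1999, Ch. II §9 Prop. (9.6)] -/
theorem not_decomp_vbar_le_layerSubgroup_one_of_isUnramifiedOutside (hK : IsImaginaryQuadratic K) {θ : K} (hθ : θ ^ 2 = -7) {d : ℤ}
    (hd0 : d ≠ 0) (W : WeierstrassCurve ℚ) [W.IsElliptic] {C : VariableChange ℚ} (hC : C • W = cm7.quadraticTwist (d : ℚ))
    {v vbar : HeightOneSpectrum (𝓞 K)} (hv : ((2 : ℕ) : 𝓞 K) ∈ v.asIdeal) (hvbar : ((2 : ℕ) : 𝓞 K) ∈ vbar.asIdeal) (hne : vbar ≠ v)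
    (κ₁ : ZpExtension K 2) (hκ₁ : κ₁.IsUnramifiedOutside v) :
    ¬ GreenbergSelmer.decomp vbar ≤ κ₁.layerSubgroup 1 := by
  obtain ⟨β', hβ', hβ'v⟩ := FirstLayer.exists_mul_one_sub_eq_two_mem hθ hv
  exact FirstLayer.not_decomp_le_layerSubgroup_one_of_exists_smul_ne hK hθ hd0 W hC hvbar hv hne.symm hβ' hβ'v κ₁ hκ₁
    (exists_mem_decomp_vbar_smul_geomSqrt_neg_ne hK hθ hd0 W hC hv hvbar hne hβ' hβ'v)

/-- **Hence a decomposition element `τ ∈ D_{v̄}` with `κ₁ τ = κ₁ γ₁`** for every topological generator `γ₁` of a `ℤ₂`-line `κ₁` of the frame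
field unramified outside `v` (part 4's `exists_mem_decomp_apply_eq_of_not_le_layerSubgroup_one`): `v̄` is UNDECOMPOSED in `K_∞^{(v)}`, so the
Euler factor of M-LINE-PIN at `v̄` is the LINEAR `(1+T) − θ(τ)` and parts 2–4 apply with `n = 1`. [cite: Washington1997, §13.1] -/
theorem exists_mem_decomp_vbar_apply_eq_of_isUnramifiedOutside (hK : IsImaginaryQuadratic K) {θ : K} (hθ : θ ^ 2 = -7) {d : ℤ}
    (hd0 : d ≠ 0) (W : WeierstrassCurve ℚ) [W.IsElliptic] {C : VariableChange ℚ} (hC : C • W = cm7.quadraticTwist (d : ℚ))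
    {v vbar : HeightOneSpectrum (𝓞 K)} (hv : ((2 : ℕ) : 𝓞 K) ∈ v.asIdeal) (hvbar : ((2 : ℕ) : 𝓞 K) ∈ vbar.asIdeal) (hne : vbar ≠ v)
    (κ₁ : ZpExtension K 2) (hκ₁ : κ₁.IsUnramifiedOutside v) {γ₁ : absoluteGaloisGroup K} (hγ₁ : κ₁.IsTopGenerator γ₁) :
    ∃ τ ∈ GreenbergSelmer.decomp vbar, κ₁ τ = κ₁ γ₁ :=
  exists_mem_decomp_apply_eq_of_not_le_layerSubgroup_one κ₁
    (not_decomp_vbar_le_layerSubgroup_one_of_isUnramifiedOutside hK hθ hd0 W hC hv hvbar hne κ₁ hκ₁) hγ₁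

end Frame

end Summit.BirchSwinnertonDyer.BirchSwinnertonDyer.Theorems.PrintCf2.LinePin

end
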